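import Literature.Analysis.FluidPDE.KNSSNoAxisymmetricTypeIHolds
import Summits.NavierStokesRegularity.NavierStokesRegularity.Theorems.AxisymmetricSwirlRegularity
import Literature.Analysis.FluidPDE.NSLerayHopfSereginEnergyProofs
import Literature.Analysis.FluidPDE.KatoFarFieldBound
import Literature.Analysis.FluidPDE.NSLerayExistenceR3Holds
import Literature.Analysis.FluidPDE.LerayLocalRegularH1Proofs
import Literature.Analysis.FluidPDE.RusinSverakLeraySolutions
import Literature.Analysis.FluidPDE.NSKatoToClayHolds
import Literature.Analysis.FluidPDE.NSLerayHopf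
import Literature.Analysis.FluidPDE.AxisymmetricNoSwirlGlobal
import Summits.NavierStokesRegularity.NavierStokesRegularity.Theorems.TypeICertificateLadderNoBlowupToClayLemmas
import Literature.Analysis.FluidPDE.TaoFiniteEnergyLerayHopf
import Literature.Analysis.FluidPDE.LerayHopfProofs
import Literature.Analysis.FluidPDE.NSWeakStrongUniquenessHolds
import Literature.Analysis.FluidPDE.NormalisedPressureDischarge
import Literature.Analysis.FluidPDE.NSFiniteEnergySmoothProofs
import HarnessLib

/-!
# `AxisymmetricSwirlRegularity` (Clay-(A) form, conjecture leaf) ⇒ global Kato solutions, symmetric slab-bounded classical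
# continuations, and no blow-up in the standing axisymmetric class — ROUTE-INDEPENDENT engine

`--supports stmt-NavierStokesRegularity-1964` (helper file; theorems only, no definitions, no `sorry`; NO `Theses` import —
the route-independent twin of `…MonopoleCoreExclusionSlabAxisymOfAX` / `…AxisymSwirlRegularIffNoBlowup`, which state the same
facts for the route decl `Theses.TypeIIInviscidRelaxation.AxisymSwirlRegular` and therefore sit in the theses cone; this file
takes the conjecture LEAF `Summit.NavierStokesRegularity.NavierStokesRegularity.AxisymmetricSwirlRegularity` instead, so that
Literature-side and other-route users can import it).

* `katoMaximalTime_eq_top_of_axisymmetricSwirlRegularity` — under the conjecture, the Kato maximal time of every smooth,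
  divergence-free, rapidly decaying, axisymmetric datum is `⊤` (Tao 2011 Lemma 8.1: the Clay solution is Leray–Hopf on every
  slab, `IsClassicalNSSolutionOn.isLerayHopfOn_of_finiteEnergy`; weak–strong uniqueness against the Tao-class patches of the
  maximal Kato solution; joint continuity of the Clay solution near the singular point of a finite maximal time);
* `slabAxisym_of_axisymmetricSwirlRegularity` — hence symmetric, bounded classical continuations on every `[0, τ]`;
* `noBlowup_of_axisymmetricSwirlRegularity` — hence every standing-class solution (classical on `[0,T)`, Leray–Hopf,
  slab-bounded, axisymmetric, decaying datum) extends smoothly past `T`.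
HONEST: conditional on the open conjecture (a hypothesis); nothing about Navier–Stokes regularity is proved.
-/

noncomputable section

open Literature.Analysis.FluidPDE MeasureTheory Set Function Filter Topology Metric
open scoped ContDiff InnerProductSpace RealInnerProductSpace

namespace Summit.NavierStokesRegularity.NavierStokesRegularity.Theorems

-- the problem directory repeats the summit name (`NavierStokesRegularity/NavierStokesRegularity`)
set_option linter.dupNamespace false

namespace AxisymKatoGlobal

/-- **`AxisymmetricSwirlRegularity` (Clay-(A) form) ⇒ the Kato maximal time of every smooth divergence-free rapidly decaying
axisymmetric datum is infinite.**  (Tao 2011 Lemma 8.1: the Clay solution is Leray–Hopf on every slab; weak–strong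
uniqueness against the Tao-class patches of the maximal Kato solution; joint continuity of the Clay solution near the
singular point of a finite maximal time.) [cite: Tao2011, Lemma 8.1] -/
theorem katoMaximalTime_eq_top_of_axisymmetricSwirlRegularity
    (hAX : Summit.NavierStokesRegularity.NavierStokesRegularity.AxisymmetricSwirlRegularity)
    {ν : ℝ} (hν : 0 < ν) {u₀ : EuclideanSpace ℝ (Fin 3) → EuclideanSpace ℝ (Fin 3)} (hsm : ContDiff ℝ ∞ u₀)
    (hdiv : VectorCalculus.IsDivFree u₀) (hdec : HasRapidSpatialDecay u₀) (haxi : IsAxisymmetric u₀) :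
    katoMaximalTime ν u₀ = ⊤ := by
  classical
  /- ### the datum: `H^∞`, `L²`, `L³`, weakly divergence free -/
  have hdivW : NSWave0.IsDivFree u₀ := fun x => hdiv x
  have hHk : ∀ n : ℕ, ∫⁻ x, ‖iteratedFDeriv ℝ n u₀ x‖ₑ ^ 2 < ⊤ :=
    hdec.lintegral_enorm_iteratedFDeriv_sq_lt_top
  have hmeas0 : AEStronglyMeasurable u₀ volume := hsm.continuous.aestronglyMeasurable
  have hL2 : ∫⁻ x, ‖u₀ x‖ₑ ^ 2 < ⊤ := by
    refine lt_of_le_of_lt (le_of_eq (lintegral_congr fun x => ?_)) (hHk 0)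
    rw [← ofReal_norm, ← ofReal_norm, norm_iteratedFDeriv_zero]
  have hu2 : MemLp u₀ 2 volume := ⟨hmeas0, eLpNorm_two_lt_top_of_lintegral_enorm_sq_lt_top hL2⟩
  obtain ⟨C₀, hC₀⟩ := hdec 0 0
  have hbd0 : ∀ x, ‖u₀ x‖ ≤ C₀ := fun x => by
    have h := hC₀ x
    rwa [pow_zero, one_mul, norm_iteratedFDeriv_zero] at h
  have hu3 : MemLp u₀ 3 volume := by
    refine ⟨hmeas0, ?_⟩
    have h3 : eLpNorm u₀ 3 volume ^ 3 ≤ eLpNorm u₀ ⊤ volume * eLpNorm u₀ 2 volume ^ 2 :=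
      eLpNorm_three_pow_le hmeas0
    have htop : eLpNorm u₀ ⊤ volume ≤ ENNReal.ofReal C₀ := eLpNorm_top_le_of_bound hbd0
    have hfin : eLpNorm u₀ ⊤ volume * eLpNorm u₀ 2 volume ^ 2 < ⊤ :=
      ENNReal.mul_lt_top (htop.trans_lt ENNReal.ofReal_lt_top)
        (ENNReal.pow_lt_top hu2.eLpNorm_lt_top)
    by_contra hnot
    rw [not_lt, top_le_iff] at hnot
    rw [hnot, ENNReal.top_pow (by norm_num)] at h3
    exact absurd (h3.trans_lt hfin) (lt_irrefl _)
  have hwdiv : IsWeaklyDivFree u₀ :=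
    VectorCalculus.IsDivFree.isWeaklyDivFree_holds hdiv (hsm.of_le (mod_cast le_top))
  /- ### suppose the Kato maximal time is finite -/
  by_contra htop
  have hTm0 : 0 < katoMaximalTime ν u₀ := katoMaximalTime_pos kato_local_holds hν hu3 hwdiv
  have htop' : katoMaximalTime ν u₀ < ⊤ := lt_top_iff_ne_top.2 htop
  obtain ⟨w, hw⟩ := exists_isKatoSolutionOn_katoMaximalTime kato_unique_holds hν hTm0 htop'
  set T : ℝ := (katoMaximalTime ν u₀).toReal with hT_def
  have hT0 : 0 < T := ENNReal.toReal_pos hTm0.ne' htop'.ne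
  have hofReal : ENNReal.ofReal T = katoMaximalTime ν u₀ := ENNReal.ofReal_toReal htop'.ne
  have hmax : ∀ T'' : ℝ, T < T'' → ∀ w' : ℝ → EuclideanSpace ℝ (Fin 3) → EuclideanSpace ℝ (Fin 3),
      ¬ IsKatoSolutionOn T'' ν u₀ w' :=
    fun T'' hT'' w' => not_isKatoSolutionOn_of_katoMaximalTime_lt (by
      rw [← hofReal]
      exact (ENNReal.ofReal_lt_ofReal_iff (hT0.trans hT'')).2 hT'')
  -- its singular point `(T, x₁)`
  obtain ⟨x₁, hx₁⟩ := lemarieRieusset_singular_point_of_blowup_holds hν hT0 hu3 hwdiv hw hmax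
  have hall : ∀ r : ℝ, 0 < r →
      eLpNorm (uncurry w) ⊤ (volume.restrict (parabolicCylinder r ((T : ℝ), x₁))) = ⊤ :=
    fun r hr => eLpNorm_top_parabolicCylinder_eq_top_of_small hT0 hx₁ hr
  /- ### the classical representative on `[0, T)`: patched Tao-class solutions -/
  set Ts : ℕ → ℝ := fun n => T - T / ((n : ℝ) + 2) with hTs_def
  have hTs0 : ∀ n, 0 < Ts n := fun n => by
    have h1 : T / ((n : ℝ) + 2) < T := by
      rw [div_lt_iff₀ (by positivity)]
      nlinarith
    simp only [hTs_def]
    linarith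
  have hTsT : ∀ n, Ts n < T := fun n => by
    have h1 : 0 < T / ((n : ℝ) + 2) := by positivity
    simp only [hTs_def]
    linarith
  have hcof : ∀ t < T, ∃ n, t < Ts n := fun t ht => by
    obtain ⟨n, hn⟩ := exists_nat_gt (T / (T - t))
    refine ⟨n, ?_⟩
    have hpos : 0 < T - t := sub_pos.2 ht
    have h1 : T < ((n : ℝ) + 2) * (T - t) := by
      rw [div_lt_iff₀ hpos] at hn
      nlinarith
    have h2 : T / ((n : ℝ) + 2) < T - t := by
      rw [div_lt_iff₀ (by positivity)]
      linarith
    simp only [hTs_def]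
    linarith
  have hex : ∀ n, ∃ (u : ℝ → EuclideanSpace ℝ (Fin 3) → EuclideanSpace ℝ (Fin 3))
      (p : ℝ → EuclideanSpace ℝ (Fin 3) → ℝ), IsTaoSolutionOn (Ts n) ν u₀ u p :=
    fun n => exists_isTaoSolutionOn_of_isKatoSolutionOn hν hsm hdivW hdec hw (hTs0 n) (hTsT n)
  choose u p hup using hex
  obtain ⟨U, P, hcl, hU0, hUeq⟩ :=
    exists_classical_of_isTaoSolutionOn_family hν hTs0 (fun n => (hTsT n).le) hcof hup
  -- `U` agrees a.e. with the Kato solution `w` on every slice of `[0, T)`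
  have hUw : ∀ t ∈ Ico 0 T, U t =ᵐ[volume] w t := by
    intro t ht
    obtain ⟨n, hn⟩ := hcof t ht.2
    rw [(hUeq n t ⟨ht.1, hn⟩).1]
    have hwn : IsKatoSolutionOn (Ts n) ν u₀ w := hw.mono (hTsT n).le
    exact (hup n).ae_eq_of_kato hν hwn.mild hwn.continuousInLpOn hwn.aestronglyMeasurable
      t ⟨ht.1, hn⟩
  -- `U` is measurable on the strip
  have hUm : AEStronglyMeasurable (uncurry U) (volume.restrict (Ioo 0 T ×ˢ univ)) :=
    (hcl.smooth_velocity.continuousOn.mono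
      (prod_mono Ioo_subset_Ico_self Subset.rfl)).aestronglyMeasurable
      (measurableSet_Ioo.prod MeasurableSet.univ)
  /- ### the Clay-(A) solution from `AxisymSwirlRegular`: Leray–Hopf on every slab (Tao), hence `= U` a.e. -/
  obtain ⟨uA, pA, hA, hA0, C, hCt, hC⟩ := hAX ν hν u₀ hsm hdiv hdec haxi
  have hAU : ∀ t ∈ Ioo 0 T, uA t =ᵐ[volume] U t := by
    intro t ht
    obtain ⟨n, hn⟩ := hcof t ht.2
    rw [(hUeq n t ⟨ht.1.le, hn⟩).1]
    have hLH : IsLerayHopfOn (Ts n) ν 0 u₀ (u n) := (hup n).isLerayHopfOn (hTs0 n)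
    obtain ⟨B, -, hB⟩ := (hup n).exists_bound_velocity
    have hSer : MemLqLp ⊤ ⊤ (u n) (Ioo 0 (Ts n)) :=
      memLqLp_top_top_of_bound (fun s hs => (hup n).aestronglyMeasurable_slice hs) hB
    have hAcl : IsClassicalNSSolutionOn (Icc 0 (Ts n)) ν 0 uA pA :=
      hA.mono Icc_subset_Ici_self (uniqueDiffOn_Icc (hTs0 n))
    have hALH : IsLerayHopfOn (Ts n) ν 0 u₀ uA := by
      have h := (hAcl.isLerayHopfOn_of_finiteEnergy tao_pressure_normalisation_holds
        tao2011_pressureTerm_estimate_holds tao_finite_energy_smooth_energy_bound_holds hν (hTs0 n)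
        ⟨C, hCt, fun s hs => hC s hs.1⟩).1
      rwa [hA0] at h
    exact weak_strong_uniqueness_holds hν (hTs0 n) hLH (q := ⊤) (r := ⊤) ENNReal.ofNat_lt_top
      (by simp [ENNReal.div_top]) hSer hALH t ⟨ht.1, hn.le⟩
  have hAm : AEStronglyMeasurable (uncurry uA) (volume.restrict (Ioo 0 T ×ˢ univ)) :=
    (hA.smooth_velocity.continuousOn.mono
      (prod_mono (fun t ht => (le_of_lt ht.1 : (0 : ℝ) ≤ t)) Subset.rfl)).aestronglyMeasurable
      (measurableSet_Ioo.prod MeasurableSet.univ)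
  /- ### the Clay solution is bounded near `(T, x₁)` — contradiction with the singularity of `w` -/
  set K : Set (ℝ × EuclideanSpace ℝ (Fin 3)) := Icc (T / 2) T ×ˢ closedBall x₁ 1 with hK_def
  have hK : IsCompact K := isCompact_Icc.prod (isCompact_closedBall _ _)
  have hKsub : K ⊆ Ici 0 ×ˢ (univ : Set (EuclideanSpace ℝ (Fin 3))) :=
    prod_mono (fun t ht => (by simp only [mem_Ici]; linarith [ht.1] : t ∈ Ici (0 : ℝ))) (subset_univ _)
  have hcont : ContinuousOn (uncurry uA) K := hA.smooth_velocity.continuousOn.mono hKsub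
  obtain ⟨M, hM⟩ := hK.exists_bound_of_continuousOn hcont
  set r : ℝ := min 1 (Real.sqrt (T / 2)) with hr_def
  have hr0 : 0 < r := lt_min one_pos (Real.sqrt_pos.2 (by positivity))
  have hr1 : r ≤ 1 := min_le_left _ _
  have hr2 : r ^ 2 ≤ T / 2 := by
    calc r ^ 2 ≤ Real.sqrt (T / 2) ^ 2 := pow_le_pow_left₀ hr0.le (min_le_right _ _) 2
      _ = T / 2 := Real.sq_sqrt (by positivity)
  have hcylK : parabolicCylinder r ((T : ℝ), x₁) ⊆ K := by
    rintro ⟨s, y⟩ hz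
    rw [mem_parabolicCylinder] at hz
    exact ⟨⟨by linarith [hz.1.1], hz.1.2.le⟩, mem_closedBall.2 (hz.2.le.trans hr1)⟩
  have hcylS : parabolicCylinder r ((T : ℝ), x₁) ⊆ Ioo 0 T ×ˢ (univ : Set (EuclideanSpace ℝ (Fin 3))) := by
    rintro ⟨s, y⟩ hz
    rw [mem_parabolicCylinder] at hz
    exact ⟨⟨by linarith [hz.1.1, hr2], hz.1.2⟩, mem_univ _⟩
  have hUA : uncurry U =ᵐ[volume.restrict (Ioo 0 T ×ˢ (univ : Set (EuclideanSpace ℝ (Fin 3))))] uncurry uA :=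
    ae_restrict_prod_of_forall_ae_eq (fun t ht => (hAU t ht).symm) hUm hAm
  have hbdU : eLpNorm (uncurry U) ⊤ (volume.restrict (parabolicCylinder r ((T : ℝ), x₁))) < ⊤ := by
    have hUAc : uncurry U =ᵐ[volume.restrict (parabolicCylinder r ((T : ℝ), x₁))] uncurry uA :=
      ae_restrict_of_ae_restrict_of_subset hcylS hUA
    rw [eLpNorm_congr_ae hUAc, eLpNorm_exponent_top]
    refine eLpNormEssSup_lt_top_of_ae_bound (C := M) ?_
    filter_upwards [ae_restrict_mem (isOpen_parabolicCylinder r ((T : ℝ), x₁)).measurableSet] with z hz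
    exact hM _ (hcylK hz)
  have hUw' : uncurry U =ᵐ[volume.restrict (Ioo 0 T ×ˢ (univ : Set (EuclideanSpace ℝ (Fin 3))))]
      uncurry w :=
    ae_restrict_prod_of_forall_ae_eq (fun t ht => hUw t ⟨ht.1.le, ht.2⟩) hUm hw.aestronglyMeasurable
  exact hbdU.ne (eLpNorm_parabolicCylinder_eq_top_of_ae_eq hT0 hUw' x₁ hall hr0)

/-- **`AxisymmetricSwirlRegularity` (Clay-(A) form) ⇒ symmetric, slab-bounded classical continuations.**  For `ν > 0`, any
horizon `τ > 0` and a smooth, divergence-free, rapidly decaying, axisymmetric datum `u₀` there is a classical solution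
`(u, p)` of the unforced system on `[0, τ] × ℝ³` with `u 0 = u₀`, axisymmetric at every time of `[0, τ]` and bounded on
`[0, τ] × ℝ³` (the Tao-class solution of the global Kato solution).  [cite: Tao2011, Lemma 8.1] -/
theorem slabAxisym_of_axisymmetricSwirlRegularity
    (hAX : Summit.NavierStokesRegularity.NavierStokesRegularity.AxisymmetricSwirlRegularity) :
    ∀ ν : ℝ, 0 < ν → ∀ τ : ℝ, 0 < τ → ∀ u₀ : EuclideanSpace ℝ (Fin 3) → EuclideanSpace ℝ (Fin 3),
      ContDiff ℝ ∞ u₀ → VectorCalculus.IsDivFree u₀ → HasRapidSpatialDecay u₀ → IsAxisymmetric u₀ →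
      ∃ (u : ℝ → EuclideanSpace ℝ (Fin 3) → EuclideanSpace ℝ (Fin 3)) (p : ℝ → EuclideanSpace ℝ (Fin 3) → ℝ),
        IsClassicalNSSolutionOn (Icc 0 τ) ν 0 u p ∧ u 0 = u₀ ∧ (∀ s ∈ Icc 0 τ, IsAxisymmetric (u s)) ∧
        ∃ M : ℝ, ∀ s ∈ Icc 0 τ, ∀ x, ‖u s x‖ ≤ M := by
  intro ν hν τ hτ u₀ hsm hdiv hdec haxi
  have hdivW : NSWave0.IsDivFree u₀ := fun x => hdiv x
  have htop := katoMaximalTime_eq_top_of_axisymmetricSwirlRegularity hAX hν hsm hdiv hdec haxi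
  obtain ⟨w, hw⟩ := exists_isKatoSolutionOn_of_ofReal_lt_katoMaximalTime (T := τ + 1) (ν := ν) (u₀ := u₀)
    (by rw [htop]; exact ENNReal.ofReal_lt_top)
  obtain ⟨u, p, hup⟩ := exists_isTaoSolutionOn_of_isKatoSolutionOn hν hsm hdivW hdec hw hτ (by linarith)
  obtain ⟨B, -, hB⟩ := hup.exists_bound_velocity
  exact ⟨u, p, hup.classical, hup.initial, hup.isAxisymmetric hν hτ haxi, B, hB⟩

/-- **`AxisymmetricSwirlRegularity` ⇒ no blow-up in the standing axisymmetric class.**  Given the conjecture (Clay-(A) form), every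
classical solution of the unforced system on `ℝ³ × [0,T)` (`ν, T > 0`) which is Leray–Hopf on `[0,T]` from its rapidly
decaying datum, bounded on every sub-slab `[0,T'] × ℝ³` (`T' < T`) and axisymmetric slice-wise extends smoothly past `T`:
the Tao-class solution from `u 0` on `[0, T+1]` (it exists since the Kato maximal time is infinite,
`katoMaximalTime_eq_top_of_axisymmetricSwirlRegularity`) coincides with `u` on `[0, T)` by weak–strong uniqueness and continuity.
[cite: Tao2011, Lemma 8.1] -/
theorem noBlowup_of_axisymmetricSwirlRegularity
    (hAX : Summit.NavierStokesRegularity.NavierStokesRegularity.AxisymmetricSwirlRegularity) :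
    ∀ (ν T : ℝ), 0 < ν → 0 < T →
      ∀ (u : ℝ → EuclideanSpace ℝ (Fin 3) → EuclideanSpace ℝ (Fin 3))
        (p : ℝ → EuclideanSpace ℝ (Fin 3) → ℝ),
        IsClassicalNSSolutionOn (Set.Ico 0 T) ν 0 u p → IsLerayHopfOn T ν 0 (u 0) u →
        (∀ T' < T, ∃ M : ℝ, ∀ t ∈ Set.Icc 0 T', ∀ x, ‖u t x‖ ≤ M) →
        (∀ t ∈ Set.Ico 0 T, IsAxisymmetric (u t)) → HasRapidSpatialDecay (u 0) →
        HasSmoothExtensionPast ν 0 u T := by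
  intro ν T hν hT u p hns hLH hbd haxi hdec
  classical
  have h0mem : (0 : ℝ) ∈ Ico 0 T := ⟨le_rfl, hT⟩
  have hsm : ContDiff ℝ ∞ (u 0) := hns.contDiff_velocity h0mem
  have hdiv : VectorCalculus.IsDivFree (u 0) := hns.divFree 0 h0mem
  have hdivW : NSWave0.IsDivFree (u 0) := fun x => hdiv x
  have hax0 : IsAxisymmetric (u 0) := haxi 0 h0mem
  -- the Tao-class solution from `u 0` on `[0, T + 1]`
  have htop := katoMaximalTime_eq_top_of_axisymmetricSwirlRegularity hAX hν hsm hdiv hdec hax0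
  obtain ⟨w, hw⟩ := exists_isKatoSolutionOn_of_ofReal_lt_katoMaximalTime (T := T + 2) (ν := ν) (u₀ := u 0)
    (by rw [htop]; exact ENNReal.ofReal_lt_top)
  obtain ⟨U, P, hup⟩ := exists_isTaoSolutionOn_of_isKatoSolutionOn hν hsm hdivW hdec hw
    (show (0 : ℝ) < T + 1 by linarith) (by linarith)
  have hU' : IsClassicalNSSolutionOn (Ico 0 (T + 1)) ν 0 U P :=
    hup.classical.mono Ico_subset_Icc_self (uniqueDiffOn_Ico 0 (T + 1))
  refine ⟨T + 1, by linarith, U, P, hU', fun t ht => ?_⟩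
  rcases eq_or_lt_of_le ht.1 with h0 | htpos
  · rw [← h0, hup.initial]
  -- weak–strong uniqueness on the horizon `T' = (t + T)/2`
  set T' : ℝ := (t + T) / 2 with hT'_def
  have htT' : t < T' := by rw [hT'_def]; linarith [ht.2]
  have hT'T : T' < T := by rw [hT'_def]; linarith [ht.2]
  have hT'0 : 0 < T' := htpos.trans htT'
  have hLH' : IsLerayHopfOn T' ν 0 (u 0) u := IsLerayHopfOn.mono_holds hLH hT'T.le
  obtain ⟨M, hM⟩ := hbd T' hT'T
  have hSer : MemLqLp ⊤ ⊤ u (Ioo 0 T') :=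
    memLqLp_top_top_of_bound
      (fun s hs => (hns.contDiff_velocity ⟨hs.1, hs.2.trans_lt hT'T⟩).continuous.aestronglyMeasurable) hM
  have hULH : IsLerayHopfOn T' ν 0 (u 0) U :=
    IsLerayHopfOn.mono_holds (hup.isLerayHopfOn (by linarith)) (by linarith)
  have hae : U t =ᵐ[volume] u t :=
    weak_strong_uniqueness_holds hν hT'0 hLH' (q := ⊤) (r := ⊤) ENNReal.ofNat_lt_top
      (by simp [ENNReal.div_top]) hSer hULH t ⟨htpos, htT'.le⟩
  have hUc : Continuous (U t) := (hup.classical.contDiff_velocity ⟨ht.1, by linarith [ht.2]⟩).continuous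
  have huc : Continuous (u t) := (hns.contDiff_velocity ht).continuous
  exact (Continuous.ae_eq_iff_eq volume hUc huc).1 hae

end AxisymKatoGlobal

end Summit.NavierStokesRegularity.NavierStokesRegularity.Theorems

end
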